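/-
Copyright: lit-balaban Phase-2 proof seat p08 (gen 7).  Statement-level skeleton of a published paper; no proof claims beyond what
the kernel checks below.
-/
import Literature.MathematicalPhysics.QuantumFieldTheory.BalabanImbrieJaffe1984to88.BIJ88Ineq217Ineq722Torus
import Literature.MathematicalPhysics.QuantumFieldTheory.BalabanImbrieJaffe1984to88.BIJ88Close218Proof
import Literature.MathematicalPhysics.QuantumFieldTheory.BalabanImbrieJaffe1984to88.BIJ88Cutoffs21

/-!
# `BalabanImbrieJaffe1984to88.BIJ88HkLocTorus` — T. Bałaban, J. Imbrie, A. Jaffe, *Effective action and cluster properties of the abelian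
Higgs model*, Commun. Math. Phys. **114** (1988) 257–315 [BalabanImbrieJaffe1988]: **(2.4)–(2.7)** p. 260 — the localized Landau minimizer
`H_{k,loc} = ζ_kH_k` — ON THE TORI OF THE SERIES FOR THE `H_k` OF RECORD: the kernel `H_k(b, b′) = (H_ke_{b′})(b)` of p11's Landau
minimizer `HkE` (= the (1.103) kernel of p09's torus carrier, gen 7's `BIJ88Ineq217Ineq722Torus.ofLp_HkE_single`), its decay *"see
(I.7.2.2)"* supplied BY THE TYPED ROW C1.Eq7.2.1-7.2.2 (r15's `KernelData.Ineq722` for the torus kernel family, i.e. given only [6I]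
Proposition 1.2 by its tree name), and r18's typed displays (2.5) `Decay`, (2.6) `Vanishes`, (2.7) `Close` INHABITED for it with p13's
constructed cutoff (2.1) (`BIJ88Cutoffs21.cutoff`) — or any (2.1)-cutoff — through p02's hence-steps `decay_loc` / r18's `loc_close`

statement-level skeleton of published theorems with citation tags; proofs where landed; nothing here is a claim about the Yang–Mills mass gap

PDF held: `paper:balaban1988-cmp114-bij-abelian-higgs-effective-action` (journal page = PDF page + 256), p. 260 [PDF 4]; [I] =
[BalabanImbrieJaffe1985] p. 325 [PDF 27].

CITATION HEADER (lean-in-tree rule).  Part of the lit-balaban TYPED SKELETON (HOME `run/shared/lean/pub/lit-balaban/`), Phase-2 proof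
seat p08 (gen 7), unit `lit-balaban-p08`; WHAT IS REPRODUCED = SKELETON rows **C2.Eq2.4**, **C2.Eq2.5**, **C2.Eq2.6**, **C2.Eq2.7** (owner
r18, referee ref-5), kind «model instance» (the torus `H_k` of record), joined to row **C1.Eq7.2.1-7.2.2** (owner r15).  Decls of record
used BY NAME (nothing restated): r18's `BIJ88Sect2Statements.Decay/Vanishes/Close/loc/Zeta21/IsCutoff/loc_close/loc_vanishes`, p02's
`BIJ88Close218Proof.decay_loc`, p13's `BIJ88Cutoffs21.cutoff/zeta21_cutoff/cutoff_mem_Icc`, r15's `BIJ85Sect7Statements.KernelData.Ineq722`,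
p09's `BIJ85Ineq722Torus.torusKernelData/distEU`, `BIJ85Ineq722DeltaA.deltaAData/ineq722_deltaA_of_prop12Printed`, p11's
`BIJ85Prop522Torus.HkE`.  TAKING line HOME/STATUS.md (gen 7, ninth target).

THE PRINTED TEXT (p. 260 [PDF 4], verbatim): *"Construct a translation invariant localization function ζ_k such that ζ_k(b,b′) = 0, if
dist(b,b′) ≧ ⅛r(e_k), 1, if dist(b,b′) ≦ (1/16)r(e_k), (2.1) and such that ζ_k is a smooth function of b. Here b ∈ T_η, b′ ∈ T₁^{(k)} …
Then the localized version of H_k has a kernel H_{k,loc}(b,b′) = ζ_k(b,b′)H_k(b,b′). (2.4) Since ζ_k and H_k have good decay properties,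
so does H_{k,loc} [see (I.7.2.2)]. Thus |H_{k,loc}(b,b′)| ≦ ce^{−c dist(b,b′)} (2.5) and the derivative and Hölder derivative of order
less than 2 also have exponential decay. Of course by construction, H_{k,loc}(b,b′) = 0, if dist(b,b′) ≧ ⅛r(e_k). (2.6) Furthermore,
H_{k,loc} − H_k is small: |H_{k,loc}(b,b′) − H_k(b,b′)| ≦ e^{−cr(e_k)}e^{−c dist(b,b′)}. (2.7)"*

THE TORUS DATA (all in the tree): the kernel `H_k(b, b′) := (H_ke_{b′})(b)` (`b ∈ T_η` an η-bond, `b′ ∈ T₁^{(k)}` a unit bond, `e_{b′}`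
the unit field at `b′`) of p11's `HkE P w c k` — by `ofLp_HkE_single` the kernel `H_{k,μν}(x; y)` of p09's carrier `torusRep P k
(deltaAData hk a)` — and the fine-site distance `dist(b, b′) := |b₋ − b′₋| = distEU P k b.src b′.src` of (7.2.2) (unit of `T₁^{(k)}`),
scaled by a factor `κ ∈ (0, 1]` where r18's one-constant display `ce^{−c dist}` requires it (below).

WHAT IS PROVED (0 `sorry`, standard axioms; theorems only — proof lane):
* §1 `abs_HkE_kernel_le_of_ineq722` — from the typed (7.2.2) for the torus family: `∃ δ > 0, M ≥ 0` with `|H_k(b, b′)| ≤ Me^{−δ dist(b,b′)}`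
  at every scale `k = lev j` (the `|H|` member; `BIJ88Ineq217Ineq722Torus.exists_bound_of_ineq722`).
* §2 **(2.5)-shape for `H_k` itself in r18's one-constant form**: `decay_HkE_torus` — `Decay (κ·dist) H_k c₇` at every scale, `c₇ = max(M, δ)`,
  `κ = δ/c₇ ∈ (0, 1]` (print's *"c denotes constants that may change from line to line"*; the single-`c` typing of `Decay` forces the prefactor
  and the rate to agree, which a rescaling of the distance by `κ ≤ 1` achieves without loss).
* §3 **(2.4)–(2.7) ON THE TORI**: for ANY (2.1)-cutoff `ζ` for the distance `κ·dist` (`Zeta21 (κ·dist) r(e_k) ζ`, `0 ≤ ζ ≤ 1`) and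
  `H_{k,loc} := loc ζ H_k` (2.4): **(2.5)** `Decay (κ·dist) H_{k,loc} c₇` (p02's `decay_loc`), **(2.6)** `Vanishes (κ·dist) H_{k,loc} (r(e_k)/8)`
  (r18's `loc_vanishes`), **(2.7)** `Close (κ·dist) H_{k,loc} H_k (c₇e^{−(c₇/2)(r(e_k)/16)}) (c₇/2)` (r18's `loc_close`) — `eq25_26_27_HkE_torus`;
  and WITH p13's CONSTRUCTED cutoff `ζ_k := cutoff (r(e_k)/16) (r(e_k)/8) (κ·dist)`: `eq25_26_27_HkE_torus_cutoff`.
* §3′ **the same in the UNSCALED distance with TWO constants** (no `κ`): `eq25_26_27_HkE_torus_unscaled(_cutoff)` — (2.5) `|H_{k,loc}(b,b′)| ≤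
  Me^{−δ dist}`, (2.6) `Vanishes dist H_{k,loc} R₀`, (2.7) `Close dist H_{k,loc} H_k (Me^{−(δ/2)R₁}) (δ/2)` for any `IsCutoff dist ζ R₁ R₀`, `0 ≤ ζ ≤ 1`
  (r18's `loc_close` argument rerun with prefactor and rate apart), and with p13's constructed cutoff.
* §4 **the same GIVEN ONLY [6I] PROPOSITION 1.2 BY ITS TREE NAME** `B5.Prop12Printed` (`ineq722_deltaA_of_prop12Printed`):
  `eq25_26_27_HkE_torus_prop12`.
HONEST SCOPE.  (i) Only the `|H_{k,loc}|` member of (2.5) (the print's derivative / Hölder members are not typed in row C2.Eq2.5 either).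
(ii) In §§2–3 the distance is the fine-site distance of (7.2.2) scaled by `κ = δ/max(M, δ) ≤ 1` (r18's one-constant `Decay`); §3′ gives
the unscaled two-constant statements.  (iii) [6I] Proposition 1.2 enters by name exactly as in row C1.Eq7.2.1-7.2.2's own files; `U = 1` real abelian
fields; torus; standing range.  (iv) No `def`, no new named fact: theorems only; NOT summit progress.
Unit `lit-balaban-p08` (literature-prover-lit-balaban-p08-g7-0), 2026-08-21.
-/

open scoped BigOperators

namespace Literature.MathematicalPhysics.QuantumFieldTheory.BalabanImbrieJaffe1984to88.BIJ88HkLocTorus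

open Balaban1983to89 hiding Site Plaq
open Balaban1983to89.LatticeFieldCalculus
open BIJ88Sect2Statements (Decay Vanishes Close loc Zeta21 IsCutoff loc_close loc_vanishes)
open BIJ88Close218Proof (decay_loc)
open BIJ88Cutoffs21 (cutoff zeta21_cutoff cutoff_mem_Icc)
open BIJ85Prop521Torus BIJ85Prop522Torus
open BIJ85Sect7Statements BIJ85Ineq722Torus
open BIJ85Ineq722ProofPart2 (settingOf)
open BIJ85Ineq722DeltaA (deltaAData ineq722_deltaA_of_prop12Printed)
open BIJ88Ineq217Ineq722Torus (ofLp_HkE_single exists_bound_of_ineq722 torusKernelData_gradH_nonneg)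
-- inside this namespace the bare `Site`/`Plaq` are the `ℤ^d` carriers of the QFT root; the torus ones are renamed:
open Balaban1983to89 renaming Site → TSite, Plaq → TPlaq

noncomputable section

variable {P : Params}

/-! ## §1  The kernel `H_k(b, b′) = (H_ke_{b′})(b)` and its decay from the typed (7.2.2) -/

/-- `H_k(b, b′) = H_{k,μν}(x; y)` for `b = ⟨x, μ⟩`, `b′ = ⟨y, ν⟩`: the kernel of p11's `HkE` is the (1.103) kernel of p09's torus carrier
(`BIJ88Ineq217Ineq722Torus.ofLp_HkE_single`, bond form). [cite: BalabanImbrieJaffe1985, (7.2.1) p.325] -/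
theorem ofLp_HkE_single_bond {k : ℕ} (hk : k ≤ P.m + P.K) {c : ℝ} (hc : c ≠ 0) {w : ℝ} (hw : 0 < w) {a : ℝ} (ha : 0 < a)
    (b : PBond P 0) (b' : PBond P k) :
    WithLp.ofLp (HkE P w c k (toEj P k (Pi.single b' 1))) b = (torusRep P k (deltaAData hk a)).H (b.src, b.dir) (b'.src, b'.dir) :=
  ofLp_HkE_single hk hc hw ha b' b.src b.dir

/-- **`|H_k(b, b′)| ≤ Me^{−δ dist(b, b′)}` AT EVERY SCALE from the typed (7.2.2)**: r15's `KernelData.Ineq722` for p09's torus kernel family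
`j ↦ torusKernelData P (lev j) (deltaAData …) …` gives `δ > 0`, `M ≥ 0` with the `|H|`-member bound for the kernel of p11's `HkE` (any
`w > 0`, `c ≠ 0`), `dist(b, b′) = distEU P k b₋ b′₋`. [cite: BalabanImbrieJaffe1985, (7.2.2) p.325] -/
theorem abs_HkE_kernel_le_of_ineq722 {lev : ℕ → ℕ} (hlev : ∀ j, lev j ≤ P.m + P.K) {a : ℝ} (ha : 0 < a) {BondU : ℕ → Type}
    {distEB : (j : ℕ) → TSite P 0 → BondU j → ℝ} {Cker : (j : ℕ) → Fin P.d → Fin P.d → TSite P (lev j) → TSite P (lev j) → ℝ}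
    {Dker : (j : ℕ) → TSite P 0 → BondU j → ℝ}
    (h722 : KernelData.Ineq722
      (fun j => torusKernelData P (lev j) (deltaAData (hlev j) a) (BondU j) (distEB j) (Cker j) (Dker j))) :
    ∃ δ M : ℝ, 0 < δ ∧ 0 ≤ M ∧ ∀ (j : ℕ) (c : ℝ), c ≠ 0 → ∀ (w : ℝ), 0 < w → ∀ (b : PBond P 0) (b' : PBond P (lev j)),
      |WithLp.ofLp (HkE P w c (lev j) (toEj P (lev j) (Pi.single b' 1))) b| ≤
        M * Real.exp (-(δ * distEU P (lev j) b.src b'.src)) := by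
  obtain ⟨δ, M, hδ, hM, hB⟩ := exists_bound_of_ineq722 hlev h722
  refine ⟨δ, M, hδ, hM, fun j c hc w hw b b' => ?_⟩
  rw [ofLp_HkE_single_bond (hlev j) hc hw ha]
  exact (le_add_of_nonneg_right torusKernelData_gradH_nonneg).trans (hB j b.dir b'.dir b.src b'.src)

/-! ## §2  r18's one-constant form: `Decay (κ·dist) H_k c₇` -/

/-- two constants to one: `Me^{−δt} ≤ c₇e^{−c₇(κt)}` with `c₇ = max(M, δ)`, `κ = δ/c₇` (`t ≥ 0` not needed: `c₇κ = δ` exactly). [folklore] -/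
private theorem two_to_one {M δ t : ℝ} (hδ : 0 < δ) :
    M * Real.exp (-(δ * t)) ≤ max M δ * Real.exp (-(max M δ) * (δ / max M δ * t)) := by
  have hc : 0 < max M δ := lt_max_of_lt_right hδ
  have h1 : max M δ * (δ / max M δ * t) = δ * t := by
    rw [← mul_assoc, mul_div_cancel₀ _ hc.ne']
  rw [neg_mul, h1]
  exact mul_le_mul_of_nonneg_right (le_max_left _ _) (Real.exp_pos _).le

/-- **`H_k` DECAYS IN r18's TYPED SENSE ON EVERY TORUS OF THE FAMILY**: from the typed (7.2.2), `∃ c₇ > 0, κ ∈ (0, 1]` with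
`Decay (κ·dist) H_k c₇` — `|H_k(b, b′)| ≤ c₇e^{−c₇·κ dist(b,b′)}` — at every scale `k = lev j` (any `w > 0`, `c ≠ 0`); `c₇ = max(M, δ)`,
`κ = δ/c₇`. [cite: BalabanImbrieJaffe1988, (2.5) p.260] -/
theorem decay_HkE_torus {lev : ℕ → ℕ} (hlev : ∀ j, lev j ≤ P.m + P.K) {a : ℝ} (ha : 0 < a) {BondU : ℕ → Type}
    {distEB : (j : ℕ) → TSite P 0 → BondU j → ℝ} {Cker : (j : ℕ) → Fin P.d → Fin P.d → TSite P (lev j) → TSite P (lev j) → ℝ}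
    {Dker : (j : ℕ) → TSite P 0 → BondU j → ℝ}
    (h722 : KernelData.Ineq722
      (fun j => torusKernelData P (lev j) (deltaAData (hlev j) a) (BondU j) (distEB j) (Cker j) (Dker j))) :
    ∃ c₇ κ : ℝ, 0 < c₇ ∧ 0 < κ ∧ κ ≤ 1 ∧ ∀ (j : ℕ) (c : ℝ), c ≠ 0 → ∀ (w : ℝ), 0 < w →
      Decay (fun (b : PBond P 0) (b' : PBond P (lev j)) => κ * distEU P (lev j) b.src b'.src)
        (fun b b' => WithLp.ofLp (HkE P w c (lev j) (toEj P (lev j) (Pi.single b' 1))) b) c₇ := by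
  obtain ⟨δ, M, hδ, hM, hB⟩ := abs_HkE_kernel_le_of_ineq722 hlev ha h722
  have hc : 0 < max M δ := lt_max_of_lt_right hδ
  refine ⟨max M δ, δ / max M δ, hc, div_pos hδ hc, (div_le_one hc).2 (le_max_right _ _), fun j c hc' w hw b b' => ?_⟩
  exact (hB j c hc' w hw b b').trans (two_to_one hδ)

/-! ## §3  (2.4)–(2.7) on the tori -/

/-- **(2.4)–(2.7) ON THE TORI FOR THE `H_k` OF RECORD, ANY (2.1)-CUTOFF**: from the typed (7.2.2) for p09's torus kernel family, `∃ c₇ > 0,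
κ ∈ (0, 1]` such that at every scale `k = lev j`, for every radius `r(e_k) > 0` [sic: any `rek`] and every localization function `ζ` with
the printed thresholds (2.1) for the distance `κ·dist` and `0 ≤ ζ ≤ 1`, the localized kernel (2.4) `H_{k,loc} = loc ζ H_k` satisfies
**(2.5)** `Decay (κ·dist) H_{k,loc} c₇`, **(2.6)** `Vanishes (κ·dist) H_{k,loc} (r(e_k)/8)` and **(2.7)** `Close (κ·dist) H_{k,loc} H_k
(c₇e^{−(c₇/2)(r(e_k)/16)}) (c₇/2)` — p. 260 *"Since ζ_k and H_k have good decay properties, so does H_{k,loc} [see (I.7.2.2)]"* with (I.7.2.2)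
supplied by the typed row (p02's `decay_loc`, r18's `loc_vanishes`/`loc_close`). [cite: BalabanImbrieJaffe1988, (2.5)–(2.7) p.260] -/
theorem eq25_26_27_HkE_torus {lev : ℕ → ℕ} (hlev : ∀ j, lev j ≤ P.m + P.K) {a : ℝ} (ha : 0 < a) {BondU : ℕ → Type}
    {distEB : (j : ℕ) → TSite P 0 → BondU j → ℝ} {Cker : (j : ℕ) → Fin P.d → Fin P.d → TSite P (lev j) → TSite P (lev j) → ℝ}
    {Dker : (j : ℕ) → TSite P 0 → BondU j → ℝ}
    (h722 : KernelData.Ineq722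
      (fun j => torusKernelData P (lev j) (deltaAData (hlev j) a) (BondU j) (distEB j) (Cker j) (Dker j))) :
    ∃ c₇ κ : ℝ, 0 < c₇ ∧ 0 < κ ∧ κ ≤ 1 ∧ ∀ (j : ℕ) (c : ℝ), c ≠ 0 → ∀ (w : ℝ), 0 < w → ∀ (rek : ℝ)
      (ζ : PBond P 0 → PBond P (lev j) → ℝ),
      Zeta21 (fun (b : PBond P 0) (b' : PBond P (lev j)) => κ * distEU P (lev j) b.src b'.src) rek ζ →
      (∀ b b', 0 ≤ ζ b b' ∧ ζ b b' ≤ 1) →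
        Decay (fun (b : PBond P 0) (b' : PBond P (lev j)) => κ * distEU P (lev j) b.src b'.src)
            (loc ζ (fun b b' => WithLp.ofLp (HkE P w c (lev j) (toEj P (lev j) (Pi.single b' 1))) b)) c₇ ∧
          Vanishes (fun (b : PBond P 0) (b' : PBond P (lev j)) => κ * distEU P (lev j) b.src b'.src)
            (loc ζ (fun b b' => WithLp.ofLp (HkE P w c (lev j) (toEj P (lev j) (Pi.single b' 1))) b)) (rek / 8) ∧
          Close (fun (b : PBond P 0) (b' : PBond P (lev j)) => κ * distEU P (lev j) b.src b'.src)
            (loc ζ (fun b b' => WithLp.ofLp (HkE P w c (lev j) (toEj P (lev j) (Pi.single b' 1))) b))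
            (fun b b' => WithLp.ofLp (HkE P w c (lev j) (toEj P (lev j) (Pi.single b' 1))) b)
            (c₇ * Real.exp (-(c₇ / 2) * (rek / 16))) (c₇ / 2) := by
  obtain ⟨c₇, κ, hc₇, hκ, hκ1, hD⟩ := decay_HkE_torus hlev ha h722
  refine ⟨c₇, κ, hc₇, hκ, hκ1, fun j c hc w hw rek ζ hζ h01 => ⟨?_, ?_, ?_⟩⟩
  · exact decay_loc h01 (hD j c hc w hw)
  · exact loc_vanishes hζ _
  · exact loc_close hc₇.le hζ h01 (hD j c hc w hw)

/-- **(2.4)–(2.7) ON THE TORI WITH p13's CONSTRUCTED CUTOFF (2.1)** `ζ_k := cutoff (r(e_k)/16) (r(e_k)/8) (κ·dist)` (`BIJ88Cutoffs21`; any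
`r(e_k) > 0`): (2.5), (2.6), (2.7) as in `eq25_26_27_HkE_torus`. [cite: BalabanImbrieJaffe1988, (2.5)–(2.7) p.260] -/
theorem eq25_26_27_HkE_torus_cutoff {lev : ℕ → ℕ} (hlev : ∀ j, lev j ≤ P.m + P.K) {a : ℝ} (ha : 0 < a) {BondU : ℕ → Type}
    {distEB : (j : ℕ) → TSite P 0 → BondU j → ℝ} {Cker : (j : ℕ) → Fin P.d → Fin P.d → TSite P (lev j) → TSite P (lev j) → ℝ}
    {Dker : (j : ℕ) → TSite P 0 → BondU j → ℝ}
    (h722 : KernelData.Ineq722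
      (fun j => torusKernelData P (lev j) (deltaAData (hlev j) a) (BondU j) (distEB j) (Cker j) (Dker j))) :
    ∃ c₇ κ : ℝ, 0 < c₇ ∧ 0 < κ ∧ κ ≤ 1 ∧ ∀ (j : ℕ) (c : ℝ), c ≠ 0 → ∀ (w : ℝ), 0 < w → ∀ (rek : ℝ), 0 < rek →
        Decay (fun (b : PBond P 0) (b' : PBond P (lev j)) => κ * distEU P (lev j) b.src b'.src)
            (loc (cutoff (rek / 16) (rek / 8) (fun (b : PBond P 0) (b' : PBond P (lev j)) => κ * distEU P (lev j) b.src b'.src))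
              (fun b b' => WithLp.ofLp (HkE P w c (lev j) (toEj P (lev j) (Pi.single b' 1))) b)) c₇ ∧
          Vanishes (fun (b : PBond P 0) (b' : PBond P (lev j)) => κ * distEU P (lev j) b.src b'.src)
            (loc (cutoff (rek / 16) (rek / 8) (fun (b : PBond P 0) (b' : PBond P (lev j)) => κ * distEU P (lev j) b.src b'.src))
              (fun b b' => WithLp.ofLp (HkE P w c (lev j) (toEj P (lev j) (Pi.single b' 1))) b)) (rek / 8) ∧
          Close (fun (b : PBond P 0) (b' : PBond P (lev j)) => κ * distEU P (lev j) b.src b'.src)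
            (loc (cutoff (rek / 16) (rek / 8) (fun (b : PBond P 0) (b' : PBond P (lev j)) => κ * distEU P (lev j) b.src b'.src))
              (fun b b' => WithLp.ofLp (HkE P w c (lev j) (toEj P (lev j) (Pi.single b' 1))) b))
            (fun b b' => WithLp.ofLp (HkE P w c (lev j) (toEj P (lev j) (Pi.single b' 1))) b)
            (c₇ * Real.exp (-(c₇ / 2) * (rek / 16))) (c₇ / 2) := by
  obtain ⟨c₇, κ, hc₇, hκ, hκ1, h⟩ := eq25_26_27_HkE_torus hlev ha h722
  exact ⟨c₇, κ, hc₇, hκ, hκ1, fun j c hc w hw rek hr =>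
    h j c hc w hw rek _ (zeta21_cutoff hr _) (cutoff_mem_Icc _ _ _)⟩

/-! ## §3′  The unscaled distance, two constants: (2.5)–(2.7) without `κ` -/

/-- **(2.4)–(2.7) ON THE TORI IN THE UNSCALED DISTANCE WITH TWO CONSTANTS**: from the typed (7.2.2), `∃ δ > 0, M ≥ 0` such that at every
scale `k = lev j`, for every localization function `ζ` with `ζ = 1` within `R₁` and `ζ = 0` beyond `R₀` for the fine-site distance
`dist(b, b′) = distEU` itself (`IsCutoff`) and `0 ≤ ζ ≤ 1`, the localized kernel `H_{k,loc} = loc ζ H_k` satisfies (2.5) `|H_{k,loc}(b,b′)| ≤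
Me^{−δ dist(b,b′)}`, (2.6) `Vanishes dist H_{k,loc} R₀` and (2.7) `Close dist H_{k,loc} H_k (Me^{−(δ/2)R₁}) (δ/2)` — r18's `loc_close` argument
rerun with prefactor `M` and rate `δ` kept apart (no rescaling of the distance). [cite: BalabanImbrieJaffe1988, (2.5)–(2.7) p.260] -/
theorem eq25_26_27_HkE_torus_unscaled {lev : ℕ → ℕ} (hlev : ∀ j, lev j ≤ P.m + P.K) {a : ℝ} (ha : 0 < a) {BondU : ℕ → Type}
    {distEB : (j : ℕ) → TSite P 0 → BondU j → ℝ} {Cker : (j : ℕ) → Fin P.d → Fin P.d → TSite P (lev j) → TSite P (lev j) → ℝ}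
    {Dker : (j : ℕ) → TSite P 0 → BondU j → ℝ}
    (h722 : KernelData.Ineq722
      (fun j => torusKernelData P (lev j) (deltaAData (hlev j) a) (BondU j) (distEB j) (Cker j) (Dker j))) :
    ∃ δ M : ℝ, 0 < δ ∧ 0 ≤ M ∧ ∀ (j : ℕ) (c : ℝ), c ≠ 0 → ∀ (w : ℝ), 0 < w → ∀ (R₁ R₀ : ℝ)
      (ζ : PBond P 0 → PBond P (lev j) → ℝ),
      IsCutoff (fun (b : PBond P 0) (b' : PBond P (lev j)) => distEU P (lev j) b.src b'.src) ζ R₁ R₀ →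
      (∀ b b', 0 ≤ ζ b b' ∧ ζ b b' ≤ 1) →
        (∀ (b : PBond P 0) (b' : PBond P (lev j)),
            |loc ζ (fun b b' => WithLp.ofLp (HkE P w c (lev j) (toEj P (lev j) (Pi.single b' 1))) b) b b'| ≤
              M * Real.exp (-(δ * distEU P (lev j) b.src b'.src))) ∧
          Vanishes (fun (b : PBond P 0) (b' : PBond P (lev j)) => distEU P (lev j) b.src b'.src)
            (loc ζ (fun b b' => WithLp.ofLp (HkE P w c (lev j) (toEj P (lev j) (Pi.single b' 1))) b)) R₀ ∧
          Close (fun (b : PBond P 0) (b' : PBond P (lev j)) => distEU P (lev j) b.src b'.src)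
            (loc ζ (fun b b' => WithLp.ofLp (HkE P w c (lev j) (toEj P (lev j) (Pi.single b' 1))) b))
            (fun b b' => WithLp.ofLp (HkE P w c (lev j) (toEj P (lev j) (Pi.single b' 1))) b)
            (M * Real.exp (-(δ / 2) * R₁)) (δ / 2) := by
  obtain ⟨δ, M, hδ, hM, hB⟩ := abs_HkE_kernel_le_of_ineq722 hlev ha h722
  refine ⟨δ, M, hδ, hM, fun j c hc w hw R₁ R₀ ζ hζ h01 => ⟨fun b b' => ?_, loc_vanishes hζ _, fun b b' => ?_⟩⟩
  · -- (2.5): `|ζH| ≤ |H|`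
    have hz : |ζ b b'| ≤ 1 := abs_le.2 ⟨by linarith [(h01 b b').1], (h01 b b').2⟩
    calc |loc ζ (fun b b' => WithLp.ofLp (HkE P w c (lev j) (toEj P (lev j) (Pi.single b' 1))) b) b b'|
        = |ζ b b'| * |WithLp.ofLp (HkE P w c (lev j) (toEj P (lev j) (Pi.single b' 1))) b| := abs_mul _ _
      _ ≤ 1 * |WithLp.ofLp (HkE P w c (lev j) (toEj P (lev j) (Pi.single b' 1))) b| :=
          mul_le_mul_of_nonneg_right hz (abs_nonneg _)
      _ ≤ M * Real.exp (-(δ * distEU P (lev j) b.src b'.src)) := by rw [one_mul]; exact hB j c hc w hw b b'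
  · -- (2.7): inside `R₁` the difference vanishes; outside, `|H| ≤ Me^{−δd} ≤ Me^{−(δ/2)R₁}e^{−(δ/2)d}`
    by_cases hab : distEU P (lev j) b.src b'.src ≤ R₁
    · have h1 := hζ.1 b b' hab
      simp only [loc, h1, one_mul, sub_self, abs_zero]
      positivity
    · rw [not_le] at hab
      have hfac : |loc ζ (fun b b' => WithLp.ofLp (HkE P w c (lev j) (toEj P (lev j) (Pi.single b' 1))) b) b b' -
          WithLp.ofLp (HkE P w c (lev j) (toEj P (lev j) (Pi.single b' 1))) b| ≤
          |WithLp.ofLp (HkE P w c (lev j) (toEj P (lev j) (Pi.single b' 1))) b| := by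
        have : loc ζ (fun b b' => WithLp.ofLp (HkE P w c (lev j) (toEj P (lev j) (Pi.single b' 1))) b) b b' -
            WithLp.ofLp (HkE P w c (lev j) (toEj P (lev j) (Pi.single b' 1))) b =
            (ζ b b' - 1) * WithLp.ofLp (HkE P w c (lev j) (toEj P (lev j) (Pi.single b' 1))) b := by
          simp only [loc]; ring
        rw [this, abs_mul]
        have hz : |ζ b b' - 1| ≤ 1 := by
          rw [abs_le]; constructor <;> linarith [(h01 b b').1, (h01 b b').2]
        calc |ζ b b' - 1| * |WithLp.ofLp (HkE P w c (lev j) (toEj P (lev j) (Pi.single b' 1))) b|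
            ≤ 1 * |WithLp.ofLp (HkE P w c (lev j) (toEj P (lev j) (Pi.single b' 1))) b| := by gcongr
          _ = _ := one_mul _
      refine hfac.trans ((hB j c hc w hw b b').trans ?_)
      rw [mul_assoc, ← Real.exp_add]
      refine mul_le_mul_of_nonneg_left (Real.exp_le_exp.2 ?_) hM
      nlinarith

/-- **… WITH p13's CONSTRUCTED CUTOFF (2.1) IN THE UNSCALED DISTANCE** `ζ_k := cutoff (r(e_k)/16) (r(e_k)/8) dist`: (2.5) two-constant, (2.6)
`Vanishes dist H_{k,loc} (r(e_k)/8)`, (2.7) `Close dist H_{k,loc} H_k (Me^{−(δ/2)(r(e_k)/16)}) (δ/2)`, one pair `(δ, M)` for all scales.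
[cite: BalabanImbrieJaffe1988, (2.5)–(2.7) p.260] -/
theorem eq25_26_27_HkE_torus_unscaled_cutoff {lev : ℕ → ℕ} (hlev : ∀ j, lev j ≤ P.m + P.K) {a : ℝ} (ha : 0 < a) {BondU : ℕ → Type}
    {distEB : (j : ℕ) → TSite P 0 → BondU j → ℝ} {Cker : (j : ℕ) → Fin P.d → Fin P.d → TSite P (lev j) → TSite P (lev j) → ℝ}
    {Dker : (j : ℕ) → TSite P 0 → BondU j → ℝ}
    (h722 : KernelData.Ineq722
      (fun j => torusKernelData P (lev j) (deltaAData (hlev j) a) (BondU j) (distEB j) (Cker j) (Dker j))) :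
    ∃ δ M : ℝ, 0 < δ ∧ 0 ≤ M ∧ ∀ (j : ℕ) (c : ℝ), c ≠ 0 → ∀ (w : ℝ), 0 < w → ∀ (rek : ℝ), 0 < rek →
        (∀ (b : PBond P 0) (b' : PBond P (lev j)),
            |loc (cutoff (rek / 16) (rek / 8) (fun (b : PBond P 0) (b' : PBond P (lev j)) => distEU P (lev j) b.src b'.src))
                (fun b b' => WithLp.ofLp (HkE P w c (lev j) (toEj P (lev j) (Pi.single b' 1))) b) b b'| ≤
              M * Real.exp (-(δ * distEU P (lev j) b.src b'.src))) ∧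
          Vanishes (fun (b : PBond P 0) (b' : PBond P (lev j)) => distEU P (lev j) b.src b'.src)
            (loc (cutoff (rek / 16) (rek / 8) (fun (b : PBond P 0) (b' : PBond P (lev j)) => distEU P (lev j) b.src b'.src))
              (fun b b' => WithLp.ofLp (HkE P w c (lev j) (toEj P (lev j) (Pi.single b' 1))) b)) (rek / 8) ∧
          Close (fun (b : PBond P 0) (b' : PBond P (lev j)) => distEU P (lev j) b.src b'.src)
            (loc (cutoff (rek / 16) (rek / 8) (fun (b : PBond P 0) (b' : PBond P (lev j)) => distEU P (lev j) b.src b'.src))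
              (fun b b' => WithLp.ofLp (HkE P w c (lev j) (toEj P (lev j) (Pi.single b' 1))) b))
            (fun b b' => WithLp.ofLp (HkE P w c (lev j) (toEj P (lev j) (Pi.single b' 1))) b)
            (M * Real.exp (-(δ / 2) * (rek / 16))) (δ / 2) := by
  obtain ⟨δ, M, hδ, hM, h⟩ := eq25_26_27_HkE_torus_unscaled hlev ha h722
  exact ⟨δ, M, hδ, hM, fun j c hc w hw rek hr => h j c hc w hw _ _ _ (zeta21_cutoff hr _) (cutoff_mem_Icc _ _ _)⟩

/-! ## §4  The same given only [6I] Proposition 1.2 by its tree name -/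

/-- **(2.4)–(2.7) ON THE TORI GIVEN ONLY [6I] PROPOSITION 1.2 BY ITS TREE NAME** `B5.Prop12Printed` for the torus carriers `settingOf (torusRep
P (lev j) (deltaAData …)) j` — row C1.Eq7.2.1-7.2.2's derivation *"(7.2.2) is a consequence of Proposition 1.2 and the representation
(1.103) of [6I]"* on the torus (`ineq722_deltaA_of_prop12Printed`) feeding `eq25_26_27_HkE_torus_cutoff`. [cite: BalabanImbrieJaffe1988, (2.5)–(2.7) p.260] -/
theorem eq25_26_27_HkE_torus_prop12 {lev : ℕ → ℕ} (hlev : ∀ j, lev j ≤ P.m + P.K) {a : ℝ} (ha : 0 < a)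
    (h12 : B5.Prop12Printed (fun j => settingOf (torusRep P (lev j) (deltaAData (hlev j) a)) j)) :
    ∃ c₇ κ : ℝ, 0 < c₇ ∧ 0 < κ ∧ κ ≤ 1 ∧ ∀ (j : ℕ) (c : ℝ), c ≠ 0 → ∀ (w : ℝ), 0 < w → ∀ (rek : ℝ), 0 < rek →
        Decay (fun (b : PBond P 0) (b' : PBond P (lev j)) => κ * distEU P (lev j) b.src b'.src)
            (loc (cutoff (rek / 16) (rek / 8) (fun (b : PBond P 0) (b' : PBond P (lev j)) => κ * distEU P (lev j) b.src b'.src))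
              (fun b b' => WithLp.ofLp (HkE P w c (lev j) (toEj P (lev j) (Pi.single b' 1))) b)) c₇ ∧
          Vanishes (fun (b : PBond P 0) (b' : PBond P (lev j)) => κ * distEU P (lev j) b.src b'.src)
            (loc (cutoff (rek / 16) (rek / 8) (fun (b : PBond P 0) (b' : PBond P (lev j)) => κ * distEU P (lev j) b.src b'.src))
              (fun b b' => WithLp.ofLp (HkE P w c (lev j) (toEj P (lev j) (Pi.single b' 1))) b)) (rek / 8) ∧
          Close (fun (b : PBond P 0) (b' : PBond P (lev j)) => κ * distEU P (lev j) b.src b'.src)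
            (loc (cutoff (rek / 16) (rek / 8) (fun (b : PBond P 0) (b' : PBond P (lev j)) => κ * distEU P (lev j) b.src b'.src))
              (fun b b' => WithLp.ofLp (HkE P w c (lev j) (toEj P (lev j) (Pi.single b' 1))) b))
            (fun b b' => WithLp.ofLp (HkE P w c (lev j) (toEj P (lev j) (Pi.single b' 1))) b)
            (c₇ * Real.exp (-(c₇ / 2) * (rek / 16))) (c₇ / 2) :=
  eq25_26_27_HkE_torus_cutoff hlev ha
    (ineq722_deltaA_of_prop12Printed lev hlev ha (fun _ => PUnit) (fun _ _ _ => 0) (fun _ _ _ _ _ => 0) (fun _ _ _ => 0) h12)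

end

end Literature.MathematicalPhysics.QuantumFieldTheory.BalabanImbrieJaffe1984to88.BIJ88HkLocTorus
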